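import Summits.Ventures.GridStability.Models.WSCC9SP
import Summits.Ventures.GridStability.Models.StructurePreservingBridge
import Literature.MathematicalPhysics.PowerSystems.FiniteEquilibriumSetIsolation
import Literature.MathematicalPhysics.PowerSystems.UnicyclicNetworkEquilibria
import Literature.MathematicalPhysics.PowerSystems.TwoMachineInfiniteBusEquivalent
import HarnessLib

/-!
# GridStability/Models/WSCC9SPPointConvergence — WSCC9-SP9 post-fault B is a RADIAL network ⇒ its
# synchronous states are finitely many per period WITHOUT computation ⇒ every cohesive / bounded motion
# LOCKS ONTO ONE synchronous state, for every damping vector `D > 0`, with NO isolation hypothesis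

LADDER-GRIDFUSION G2.b / G3 (model register), seat gridfusion-model-2 (g9) filing a file PREPARED BY
gridfusion-lit-1 (g10) (template `HOME/lean/lit-1/templates/WSCC9SPRadialPointConvergence.lean`, sha16
803e806972acf09e, 2026-08-27T21:28Z — «Summits side is the model seat's»; statements and proofs are
lit-1's, unchanged; model-2 owns the record `Models/WSCC9SP.lean`). `plan/MODEL-VALIDITY.md` row **MV-3**
(structure-preserving Bergen–Hill form), instance «WSCC9-SP9» post-fault B (tokens of `WSCC9SP.lean`).
Line «G2.b-SP-EQ-ISOLATION-THM» instance. Ingredients (all on tree): `Models/WSCC9SP.lean` (record,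
tree literals `parentV`/`depthV`/`treeEdge`, `b_symm`, `wt_pos`), lit-1
`AcyclicSynchronizationCondition.lean` §«Finitely many synchronous states per period on a tree»
(`RadialNetwork.finite_pinned_equilibria`, p572655), `UnicyclicNetworkEquilibria.lean` §5
(`UnicyclicNetwork.finite_pinned_Icc_of_finite_pinned_Ico`, p572179),
`FiniteEquilibriumSetIsolation.lean` §3 (`BergenHill.tendsto_syncFrame_of_cohesive_of_finite`,
`…_of_bounded_of_finite`, p562577), model-2 `StructurePreservingBridge.lean` (`Params.toBergenHill`).
[cite: BergenHill1981]; [cite: Padiyar2013, §3.2 eqs (3.2)–(3.5)].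
THREE COLUMNS: CERTIFIED for MODEL MV-3 record WSCC9-SP9 post-B (tokens of `WSCC9SP.lean`);
VALIDATED nothing numerical; MODELLED as the record. Nothing here says the WSCC system is stable.
-/

noncomputable section

open Real Set Filter Topology Finset

namespace Summit.Ventures.GridStability.Models.WSCC9SP

open StructurePreserving StructurePreserving.Params
open Literature.MathematicalPhysics.PowerSystems
open Literature.MathematicalPhysics.PowerSystems.ClassicalModel

/-- Depth bookkeeping of the BFS tree of block (d). -/
theorem depthV_parentV : ∀ i : Fin 9, i ≠ 6 → depthV i = depthV (parentV i) + 1 := by decide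

/-- **The post-B coupling graph is the BFS tree**: a nonzero coupling joins a node to its parent. -/
theorem b_support : ∀ i j : Fin 9, i ≠ j → b i j ≠ 0 →
    (i ≠ 6 ∧ j = parentV i) ∨ (j ≠ 6 ∧ i = parentV j) := by
  intro i j _ hb
  obtain ⟨e, ⟨h1, h2⟩ | ⟨h1, h2⟩⟩ := exists_edge_of_symmetrize_ne_zero hb
  · subst h1 h2
    fin_cases e <;> decide
  · subst h1 h2
    fin_cases e <;> decide

/-- The tree edges are live: `b_{i, parent i} ≠ 0` (it is the listed weight `wt (treeEdge i) > 0`). -/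
theorem b_parentV_ne_zero : ∀ i : Fin 9, i ≠ 6 → b i (parentV i) ≠ 0 := by
  intro i hi
  refine symmetrize_edgeWeight_ne_zero_of_edge wt_nonneg (treeEdge i) (wt_pos _) ?_
  exact (by decide : ∀ v : Fin 9, v ≠ 6 →
    (srcV (treeEdge v) = v ∧ tgtV (treeEdge v) = parentV v)
      ∨ (srcV (treeEdge v) = parentV v ∧ tgtV (treeEdge v) = v)) i hi

/-- Inertia constants are nonnegative (zero at the buses, positive at the machines). -/
theorem M_nonneg (D : Fin 9 → ℝ) : ∀ i, 0 ≤ (params D).toBergenHill.M i := by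
  intro i
  change (0 : ℝ) ≤ ((MQ i : ℚ) : ℝ)
  have : (0 : ℚ) ≤ MQ i := by fin_cases i <;> norm_num [MQ]
  exact_mod_cast this

/-- **CENSUS WITHOUT COMPUTATION**: for every damping vector, the synchronous states of the
WSCC9-SP9 post-B record pinned at G1 (`δ₆ = 0`) in the closed period box `[−π, π]⁹` are finitely
many (radial network: `RadialNetwork.finite_pinned_equilibria` + closed-box transfer). -/
theorem finite_pinned_syncEquilibria (D : Fin 9 → ℝ) :
    {δ : Fin 9 → ℝ | δ 6 = 0 ∧ (∀ i, δ i ∈ Icc (-π) π) ∧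
      ∀ i, (params D).toBergenHill.flow δ i = (params D).toBergenHill.shiftedInjection i}.Finite :=
  UnicyclicNetwork.finite_pinned_Icc_of_finite_pinned_Ico b
    (fun i => (params D).toBergenHill.shiftedInjection i) 6
    (RadialNetwork.finite_pinned_equilibria depthV_parentV b b_symm b_support b_parentV_ne_zero _)

/-- ★ **POINT CONVERGENCE OF COHESIVE MOTIONS, NO ISOLATION HYPOTHESIS** (MODEL MV-3, record
WSCC9-SP9 post-B, every `D > 0`): along every solution of the Bergen–Hill equations of
`(params D).toBergenHill` whose bus-angle differences stay bounded (any bound), the angles read in the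
synchronous frame CONVERGE to ONE synchronous state and every bus frequency tends to `ω₀`
(= 0 on this eq=b record, `syncFreq_eq_zero`). -/
theorem tendsto_syncState_of_cohesive {D : Fin 9 → ℝ} (hD : ∀ i, 0 < D i)
    {δ v : ℝ → Fin 9 → ℝ} (hsol : ∀ t, 0 ≤ t → (params D).toBergenHill.IsSolutionAt δ v t)
    {B : ℝ} (hB : ∀ t, 0 ≤ t → ∀ i j, |δ t i - δ t j| ≤ B) :
    ∃ δe : Fin 9 → ℝ,
      (∀ i, (params D).toBergenHill.flow δe i = (params D).toBergenHill.shiftedInjection i) ∧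
      Tendsto (fun t => fun i => δ t i - (params D).toBergenHill.syncFrequency * t) atTop (𝓝 δe) ∧
      Tendsto v atTop (𝓝 fun _ => (params D).toBergenHill.syncFrequency) :=
  BergenHill.tendsto_syncFrame_of_cohesive_of_finite (S := (params D).toBergenHill)
    (fun i j => b_symm i j) (M_nonneg D) hD 6 (finite_pinned_syncEquilibria D) hsol hB

/-- ★ **POINT CONVERGENCE OF BOUNDED FRAME ORBITS** (same record): a solution whose synchronous-frame
state stays in a compact set converges to ONE synchronous state. -/
theorem tendsto_syncState_of_bounded {D : Fin 9 → ℝ} (hD : ∀ i, 0 < D i)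
    {δ v : ℝ → Fin 9 → ℝ} (hsol : ∀ t, 0 ≤ t → (params D).toBergenHill.IsSolutionAt δ v t)
    {K : Set ((Fin 9 → ℝ) × (Fin 9 → ℝ))} (hK : IsCompact K)
    (hXK : ∀ t, 0 ≤ t →
      ((fun i => δ t i - (params D).toBergenHill.syncFrequency * t),
        (fun i => v t i - (params D).toBergenHill.syncFrequency)) ∈ K) :
    ∃ δe : Fin 9 → ℝ,
      (∀ i, (params D).toBergenHill.flow δe i = (params D).toBergenHill.shiftedInjection i) ∧
      Tendsto (fun t => fun i => δ t i - (params D).toBergenHill.syncFrequency * t) atTop (𝓝 δe) ∧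
      Tendsto v atTop (𝓝 fun _ => (params D).toBergenHill.syncFrequency) :=
  BergenHill.tendsto_syncFrame_of_bounded_of_finite (S := (params D).toBergenHill)
    (fun i j => b_symm i j) (M_nonneg D) hD 6 (finite_pinned_syncEquilibria D) hsol hK hXK

end Summit.Ventures.GridStability.Models.WSCC9SP

end

/-! ### (Append — riders «#143′ COUNT-256» + EVERY-MOTION on ★ #143, lead g9 RULING 9cj (3)(b): «whoever appends (model-1 if idle)»;
### statements and proofs are gridfusion-lit-1 g10's template v3 `HOME/lean/lit-1/templates/WSCC9SPRadialPointConvergence.lean`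
### 96f87d169e6b28fa, UNCHANGED; filed by gridfusion-model-1 g8; the record `Models/WSCC9SP.lean` and this file's first part are model-2 g9's)

THREE COLUMNS.  CERTIFIED: for MODEL MV-3 (structure-preserving Bergen–Hill form of the WSCC9-SP9 post-fault-B record, every damping
vector `D > 0`): exactly `2⁸ = 256` synchronous states per period pinned at G1 (`ncard_pinned_syncEquilibria`, lit-1 g10's
`RadialNetwork.ncard_pinned_equilibria_eq` p573494 by name), and along EVERY solution EITHER `Σᵢ |P̄ᵢ|·|δᵢ − δₖ| → +∞` for every
reference bus `k` OR the sync-frame angles converge to ONE synchronous state with all frequencies → ω₀ (`desync_or_tendsto_syncState`,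
lit-1 g9's `BergenHill.acyclic_tendsto_syncFrame_or_diverge` by name — the H44 honest-framing clause of 9cg (1): this capability was
ALREADY the tree's for acyclic networks and is instantiated here, not new).  VALIDATED / MODELLED: nothing new; radial post-B record as
★ #143; no sentence says a machine or the grid is stable.  [cite: BergenHill1981] [cite: Padiyar2013, §3.2 eqs (3.2)–(3.5)] -/

noncomputable section

open Real Set Filter Topology Finset

namespace Summit.Ventures.GridStability.Models.WSCC9SP

open StructurePreserving StructurePreserving.Params
open Literature.MathematicalPhysics.PowerSystems
open Literature.MathematicalPhysics.PowerSystems.ClassicalModel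

/-! ## Exactly 256 synchronous states per period (lit-1 `RadialNetwork.ncard_pinned_equilibria_eq`,
AcyclicSynchronizationCondition.lean APPEND p573494) -/

/-- The tree edges have POSITIVE coupling. -/
theorem b_parentV_pos : ∀ i : Fin 9, i ≠ 6 → 0 < b i (parentV i) := fun i hi =>
  lt_of_le_of_ne (b_nonneg _ _) (b_parentV_ne_zero i hi).symm

/-- The eq=b edge flows `uᵢ = b_{i, parent i} sin(δ₀ᵢ − δ₀_{parent i})` are STRICTLY feasible
(`|uᵢ| < b_{i, parent i}`: every post-B branch angle is `≤ θ < π/2`). -/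
theorem edgeFlow_lt : ∀ i : Fin 9, i ≠ 6 →
    |b i (parentV i) * Real.sin (δ₀ i - δ₀ (parentV i))| < b i (parentV i) := by
  intro i hi
  have hb := b_parentV_pos i hi
  have hw : |δ₀ i - δ₀ (parentV i)| ≤ θ := by
    have := window (fun _ => 1) i (parentV i) (by rw [params_b]; exact (b_parentV_ne_zero i hi))
    exact this
  have hθ := theta_bounds
  have hcos : 0 < Real.cos (δ₀ i - δ₀ (parentV i)) := by
    apply Real.cos_pos_of_mem_Ioo
    constructor <;> [linarith [(abs_le.mp hw).1]; linarith [(abs_le.mp hw).2]]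
  have hsin : |Real.sin (δ₀ i - δ₀ (parentV i))| < 1 := by
    rw [abs_lt]
    have h1 := Real.sin_sq_add_cos_sq (δ₀ i - δ₀ (parentV i))
    constructor <;> nlinarith
  rw [abs_mul, abs_of_pos hb]
  calc b i (parentV i) * |Real.sin (δ₀ i - δ₀ (parentV i))|
      < b i (parentV i) * 1 := mul_lt_mul_of_pos_left hsin hb
    _ = b i (parentV i) := mul_one _

/-- ★ **EXACTLY `2⁸ = 256` SYNCHRONOUS STATES PER PERIOD** of the WSCC9-SP9 post-B record, for
EVERY damping vector `D` (the equations do not involve `D`: `ω₀ = 0`): the solutions of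
`f(δ) = P̄` pinned at G1 in the half-open period box `[−π, π)⁹` number 256 — one per branch pattern
of the 8 tree edges; exactly ONE of them (all branches `+`, the record's `δ₀` modulo `2π`) is
phase-cohesive. -/
theorem ncard_pinned_syncEquilibria (D : Fin 9 → ℝ) :
    {δ : Fin 9 → ℝ | δ 6 = 0 ∧ (∀ i, δ i ∈ Ico (-π) π) ∧
      ∀ i, (params D).toBergenHill.flow δ i = (params D).toBergenHill.shiftedInjection i}.ncard
      = 256 := by
  have hcons : ∀ i, (params D).toBergenHill.shiftedInjection i =
      (if i ≠ 6 then b i (parentV i) * Real.sin (δ₀ i - δ₀ (parentV i)) else 0)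
        - ∑ j ∈ Finset.univ.filter (fun j => j ≠ 6 ∧ parentV j = i),
            b j (parentV j) * Real.sin (δ₀ j - δ₀ (parentV j)) := by
    intro i
    have h := isSyncEquilibrium D i
    rw [← RadialNetwork.flow_eq_treeFlow depthV_parentV b b_symm b_support δ₀ i]
    exact h.symm
  have h := RadialNetwork.ncard_pinned_equilibria_eq (by decide : depthV 6 = 0) depthV_parentV b
    b_symm b_support b_parentV_pos (fun i => (params D).toBergenHill.shiftedInjection i)
    (fun i => b i (parentV i) * Real.sin (δ₀ i - δ₀ (parentV i))) hcons edgeFlow_lt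
  exact h

/-! ## Every motion: desynchronise or lock (lit-1 g9 `BergenHill.acyclic_tendsto_syncFrame_or_diverge`,
TwoMachineInfiniteBusEquivalent.lean §10 — leaf peeling, no census, no isolation hypothesis) -/

/-- ★ **DICHOTOMY FROM EVERY SOLUTION** (MODEL MV-3, record WSCC9-SP9 post-B, every `D > 0`): along
EVERY Bergen–Hill solution EITHER `Σᵢ |P̄ᵢ|·|δᵢ − δₖ| → +∞` for every reference bus `k` (loss of
synchronism) OR the sync-frame angles converge to ONE synchronous state and all bus frequencies tend
to `ω₀` — the radial-network theorem of lit-1 g9 instantiated (stronger than the cohesive / bounded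
statements above, which it implies). -/
theorem desync_or_tendsto_syncState {D : Fin 9 → ℝ} (hD : ∀ i, 0 < D i)
    {δ v : ℝ → Fin 9 → ℝ} (hsol : ∀ t, 0 ≤ t → (params D).toBergenHill.IsSolutionAt δ v t) :
    (∀ k, Tendsto (fun t => ∑ i, |(params D).toBergenHill.shiftedInjection i| * |δ t i - δ t k|)
        atTop atTop) ∨
      (∃ δs : Fin 9 → ℝ,
        (∀ k, (params D).toBergenHill.flow δs k = (params D).toBergenHill.shiftedInjection k) ∧
        Tendsto (fun t => fun k => δ t k - (params D).toBergenHill.syncFrequency * t) atTop (𝓝 δs) ∧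
        ∀ k, Tendsto (fun t => v t k) atTop (𝓝 (params D).toBergenHill.syncFrequency)) :=
  BergenHill.acyclic_tendsto_syncFrame_or_diverge (S := (params D).toBergenHill)
    (fun i j => b_symm i j) (M_nonneg D) hD (r := 6) (parent := parentV) (rk := depthV)
    (by decide) (by decide) (fun i j hij hb => by
      rcases b_support i j hij hb with ⟨-, h⟩ | ⟨-, h⟩
      · exact Or.inl h
      · exact Or.inr h)
    b_parentV_ne_zero hsol

end Summit.Ventures.GridStability.Models.WSCC9SP

end
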